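import Mathlib
import HarnessLib
import Summits.ValiantsHypothesis.ValiantsHypothesis.Theorems.MonotoneRestorationOrbitRestorationQPCorePatternsPolyU
import Summits.ValiantsHypothesis.ValiantsHypothesis.Theorems.MonotoneRestorationOrbitRestorationQPStableLocalFactors

/-!
# Exactly permuted families of polynomial local forms WITH `U` have narrow products (SPAN currency)

Route MonotoneRestoration, crux `OrbitRestorationQP` (stmt-ValiantsHypothesis-18293), SPAN-currency lane of the open
sub-rung A_∞ (`stub_sigmaPiSigmaValue`).  Helper (`--supports`), def-free.  Version WITH THE TOTAL SUM `U` of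
`CorePatterns.prod_mem_narrowSpan_of_stable_localPolyFactors` (`…StableLocalPolyFactors.lean`): the local forms are
polynomials in the atoms `x_{ab}`, `R_a`, `C_b` AND `U = Σ_{ij} x_{ij}` (so that products of local AFFINE forms
`β₀ + δU + …` with a common support are covered):

* **`prod_mem_narrowSpan_of_stable_localPolyUFactors`** — a finite family `(Lf_i)` of PLACED POLYNOMIAL LOCAL FORMS
  WITH `U` (`Lf_i = P_i(x_{φ_i a, ψ_i b}, R_{φ_i a}, C_{ψ_i b}, U)` for a polynomial `P_i` in the atoms and `U` of a core
  `Fin r_i × Fin c_i` with `r_i + c_i + 1 ≤ w`, placed injectively) that is EXACTLY permuted by every row/column renaming has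
  `Π_i Lf_i ∈ span_ℂ {hom_{F,n} : tw F ≤ w}` — polynomial orbits.  Proof as in the affine case: Newton on the whole
  family (`NarrowSpanNewton.prod_mem_narrowSpan_of_psum_mem`), permutation averaging of the power sums
  (`exists_sum_perm_comp_eq`), and INJ with `U` for the polynomial `P_i ^ m` (`sum_injective_injective_aevalU_mem_narrowSpan`).

Lane note: this is the form needed by the BLOCK-UNTWISTED case of the twisted residue (blocks = products of the
affine factors `β₀ + δU + …` of a matrix-symmetric product with a common row/column support, rescaled by
`NormalisedFactors.exists_rescaling_of_eigenFree_transport`).  No registered stub is closed; the crux and VP ≠ VNP are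
not moved. [folklore]
-/

noncomputable section

-- `Summit.ValiantsHypothesis.ValiantsHypothesis.…` is the tree's single-conjunct layout (Sub = Summit).
set_option linter.dupNamespace false

namespace Summit.ValiantsHypothesis.ValiantsHypothesis.Theorems

namespace CorePatterns

open MvPolynomial Finset Equiv
open Literature.Computability.AlgebraicComplexity (homPoly)
open Literature.Combinatorics.SimpleGraph (treewidth)

/-- **Exactly permuted families of placed polynomial local forms with `U` have narrow products.**  If every `Lf i` is
a polynomial in the local atoms and `U` of a core `Fin r × Fin c` (`r + c + 1 ≤ w`) placed injectively, and every row/column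
renaming permutes the family exactly, then `Π_i Lf_i ∈ span_ℂ {hom_{F,n} : tw F ≤ w}`.
[folklore; cite: DwivediPagoSeppelt2026, §8] -/
theorem prod_mem_narrowSpan_of_stable_localPolyUFactors (n w : ℕ) {ι : Type} [Fintype ι]
    (Lf : ι → MvPolynomial (Fin n × Fin n) ℂ)
    (hstab : ∀ σ τ : Perm (Fin n), ∃ κ : Perm ι, ∀ i,
      rename (fun P : Fin n × Fin n => (σ P.1, τ P.2)) (Lf i) = Lf (κ i))
    (hloc : ∀ i, ∃ (r c : ℕ) (eR : Fin r → Fin n) (eC : Fin c → Fin n)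
      (P : MvPolynomial (((Fin r × Fin c) ⊕ (Fin r ⊕ Fin c)) ⊕ Unit) ℂ), r + c + 1 ≤ w ∧ Function.Injective eR ∧
      Function.Injective eC ∧
      Lf i = aeval (Sum.elim (Sum.elim (fun ab : Fin r × Fin c => (X (eR ab.1, eC ab.2) : MvPolynomial (Fin n × Fin n) ℂ))
        (Sum.elim (fun a : Fin r => ∑ j : Fin n, (X (eR a, j) : MvPolynomial (Fin n × Fin n) ℂ))
          (fun b : Fin c => ∑ j : Fin n, (X (j, eC b) : MvPolynomial (Fin n × Fin n) ℂ))))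
        (fun _ : Unit => ∑ i : Fin n, ∑ j : Fin n, (X (i, j) : MvPolynomial (Fin n × Fin n) ℂ))) P) :
    (∏ i, Lf i) ∈ Submodule.span ℂ {p : MvPolynomial (Fin n × Fin n) ℂ |
        ∃ (a b : ℕ) (E : Multiset (Fin a × Fin b)),
          treewidth (SimpleGraph.fromRel fun u v : Fin a ⊕ Fin b =>
            ∃ e ∈ E, u = Sum.inl e.1 ∧ v = Sum.inr e.2) ≤ w ∧ p = homPoly E n ℂ} := by
  classical
  refine NarrowSpanNewton.prod_mem_narrowSpan_of_psum_mem n w Lf fun m => ?_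
  -- |G| • P_m = Σ_i Σ_{σ,τ} ((σ,τ)·Lf_i)^m
  have hG : ∀ σ τ : Perm (Fin n), (∑ i, (rename (fun P : Fin n × Fin n => (σ P.1, τ P.2)) (Lf i)) ^ m) =
      ∑ i, Lf i ^ m := by
    intro σ τ
    obtain ⟨κ, hκ⟩ := hstab σ τ
    simp_rw [hκ]
    exact Equiv.sum_comp κ (fun i => Lf i ^ m)
  have hsum : (∑ i, ∑ σ : Perm (Fin n), ∑ τ : Perm (Fin n),
        (rename (fun P : Fin n × Fin n => (σ P.1, τ P.2)) (Lf i)) ^ m) =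
      (Fintype.card (Perm (Fin n)) * Fintype.card (Perm (Fin n))) • ∑ i, Lf i ^ m := by
    rw [Finset.sum_comm]
    have h2 : ∀ σ : Perm (Fin n), (∑ i, ∑ τ : Perm (Fin n),
        (rename (fun P : Fin n × Fin n => (σ P.1, τ P.2)) (Lf i)) ^ m) =
        Fintype.card (Perm (Fin n)) • ∑ i, Lf i ^ m := by
      intro σ
      rw [Finset.sum_comm]
      simp_rw [hG]
      rw [Finset.sum_const, Finset.card_univ]
    simp_rw [h2]
    rw [Finset.sum_const, Finset.card_univ, smul_smul]
  -- each inner double average is a multiple of an injective-placement sum of `P_i ^ m`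
  have hmem : (∑ i, ∑ σ : Perm (Fin n), ∑ τ : Perm (Fin n),
        (rename (fun P : Fin n × Fin n => (σ P.1, τ P.2)) (Lf i)) ^ m) ∈
      Submodule.span ℂ {p : MvPolynomial (Fin n × Fin n) ℂ |
        ∃ (a b : ℕ) (E : Multiset (Fin a × Fin b)),
          treewidth (SimpleGraph.fromRel fun u v : Fin a ⊕ Fin b =>
            ∃ e ∈ E, u = Sum.inl e.1 ∧ v = Sum.inr e.2) ≤ w ∧ p = homPoly E n ℂ} := by
    refine Submodule.sum_mem _ fun i _ => ?_
    obtain ⟨r, c, eR, eC, P, hw, heR, heC, hLi⟩ := hloc i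
    obtain ⟨N₁, -, hN₁⟩ := exists_sum_perm_comp_eq eR heR
    obtain ⟨N₂, -, hN₂⟩ := exists_sum_perm_comp_eq eC heC
    rw [hLi]
    simp only [rename_rowCol_aevalU_atoms, ← map_pow]
    have h1 := hN₁ (fun φ => ∑ τ : Perm (Fin n),
      aeval (Sum.elim (Sum.elim (fun ab : Fin r × Fin c => (X (φ ab.1, (⇑τ ∘ eC) ab.2) : MvPolynomial (Fin n × Fin n) ℂ))
        (Sum.elim (fun a : Fin r => ∑ j : Fin n, (X (φ a, j) : MvPolynomial (Fin n × Fin n) ℂ))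
          (fun b : Fin c => ∑ j : Fin n, (X (j, (⇑τ ∘ eC) b) : MvPolynomial (Fin n × Fin n) ℂ))))
        (fun _ : Unit => ∑ i : Fin n, ∑ j : Fin n, (X (i, j) : MvPolynomial (Fin n × Fin n) ℂ))) (P ^ m))
    rw [h1]
    have h2 : ∀ φ : Fin r → Fin n, (∑ τ : Perm (Fin n),
      aeval (Sum.elim (Sum.elim (fun ab : Fin r × Fin c => (X (φ ab.1, (⇑τ ∘ eC) ab.2) : MvPolynomial (Fin n × Fin n) ℂ))
        (Sum.elim (fun a : Fin r => ∑ j : Fin n, (X (φ a, j) : MvPolynomial (Fin n × Fin n) ℂ))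
          (fun b : Fin c => ∑ j : Fin n, (X (j, (⇑τ ∘ eC) b) : MvPolynomial (Fin n × Fin n) ℂ))))
        (fun _ : Unit => ∑ i : Fin n, ∑ j : Fin n, (X (i, j) : MvPolynomial (Fin n × Fin n) ℂ))) (P ^ m)) =
      N₂ • ∑ ψ ∈ (univ : Finset (Fin c → Fin n)).filter (fun ψ => Function.Injective ψ),
        aeval (Sum.elim (Sum.elim (fun ab : Fin r × Fin c => (X (φ ab.1, ψ ab.2) : MvPolynomial (Fin n × Fin n) ℂ))
          (Sum.elim (fun a : Fin r => ∑ j : Fin n, (X (φ a, j) : MvPolynomial (Fin n × Fin n) ℂ))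
            (fun b : Fin c => ∑ j : Fin n, (X (j, ψ b) : MvPolynomial (Fin n × Fin n) ℂ))))
          (fun _ : Unit => ∑ i : Fin n, ∑ j : Fin n, (X (i, j) : MvPolynomial (Fin n × Fin n) ℂ))) (P ^ m) := by
      intro φ
      exact hN₂ (fun ψ =>
        aeval (Sum.elim (Sum.elim (fun ab : Fin r × Fin c => (X (φ ab.1, ψ ab.2) : MvPolynomial (Fin n × Fin n) ℂ))
          (Sum.elim (fun a : Fin r => ∑ j : Fin n, (X (φ a, j) : MvPolynomial (Fin n × Fin n) ℂ))
            (fun b : Fin c => ∑ j : Fin n, (X (j, ψ b) : MvPolynomial (Fin n × Fin n) ℂ))))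
          (fun _ : Unit => ∑ i : Fin n, ∑ j : Fin n, (X (i, j) : MvPolynomial (Fin n × Fin n) ℂ))) (P ^ m))
    simp_rw [h2]
    simp_rw [← Finset.smul_sum]
    refine nsmul_mem (nsmul_mem ?_ _) _
    refine (Submodule.span_mono ?_) (sum_injective_injective_aevalU_mem_narrowSpan n r c (P ^ m))
    rintro p ⟨a, b, E, hE, rfl⟩
    exact ⟨a, b, E, hE.trans hw, rfl⟩
  -- divide by |G|
  have hcard : ((Fintype.card (Perm (Fin n)) * Fintype.card (Perm (Fin n)) : ℕ) : ℂ) ≠ 0 := by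
    have : 0 < Fintype.card (Perm (Fin n)) := Fintype.card_pos
    exact_mod_cast (Nat.mul_pos this this).ne'
  have : (∑ i, Lf i ^ m) = ((Fintype.card (Perm (Fin n)) * Fintype.card (Perm (Fin n)) : ℕ) : ℂ)⁻¹ •
      ((Fintype.card (Perm (Fin n)) * Fintype.card (Perm (Fin n))) • ∑ i, Lf i ^ m) := by
    rw [← Nat.cast_smul_eq_nsmul ℂ, inv_smul_smul₀ hcard]
  rw [this, ← hsum]
  exact Submodule.smul_mem _ _ hmem

end CorePatterns

end Summit.ValiantsHypothesis.ValiantsHypothesis.Theorems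

end
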